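import Mathlib
import HarnessLib
import Summits.Ventures.LatticeQCDFlow.Scoring.KishESSConsistency
import Summits.Ventures.LatticeQCDFlow.Scoring.UStatisticVarianceEstimator

/-!
# ASYMPTOTIC NORMALITY of the printed Kish ESS fraction: `√n (Kₙ − 1/M₂) ⇒ N(0, σ²_K/M₂⁴)` with
# `σ²_K = Var_q[2M₂w − w²]`, by LINEARISATION — the delta method done by hand with ONE scalar CLT:
# `M₂W̄ₙ² − F̄ₙ = mean of (2M₂wᵢ − wᵢ² − M₂) + M₂(W̄ₙ − 1)²`, the square term being `o_P(n^{-1/2})`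

HONEST FRAMING: exact (Metropolis-corrected) sampling algorithms for lattice gauge theory;
figures of merit are autocorrelation/cost numbers at stated couplings and volumes; no
continuum-physics claim.

Venture `LatticeQCDFlow` (cell pub-lqcd), topic `Scoring`; FANOUT row 4 (`s0-u1-b`, rung S0-B).
Row 4's asymptotic-normality packet covers the observable column
(`Scoring/SelfNormalisedReweightingCLT`) and the acceptance column
(`Scoring/AllPairsAcceptanceRatioCLT`); the third printed column, the Kish fraction
`Kₙ = (Σ_{i<n} w̃ᵢ)²/(n Σ_{i<n} w̃ᵢ²) = W̄ₙ²/F̄ₙ` (`Scoring/KishESSConsistency`, imported: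
`Kₙ → 1/M₂` almost surely, `M₂ = ∫ p²/q dμ`), had no limit law.  A delta method for
`g(W̄, F̄) = W̄²/F̄` would need a bivariate CLT, which Mathlib does not have; but the
linearisation can be done BY HAND with one scalar CLT: `M₂W̄² − F̄ = (1/n)Σᵢ ξ(yᵢ) + M₂(W̄ − 1)²`
EXACTLY, with the mean-zero score `ξ = 2M₂w − w² − M₂ ∈ L²(q dμ)` (fourth weight moment
`p⁴/q³ ∈ L¹(μ)`), so `√n (Kₙ − 1/M₂) = [(√n)⁻¹Σᵢ ξ(yᵢ) + M₂·√n(W̄ − 1)²]/(M₂F̄)`; Mathlib's CLT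
handles the first term, the second has expectation exactly `M₂(M₂ − 1)/√n → 0` hence tends to
`0` in probability (Markov, `tendstoInMeasure_zero_of_integral_le` of
`Scoring/UStatisticVarianceEstimator`, imported), `F̄ → M₂` almost surely, and two Slutsky steps
finish.  Printed counterparts NAMED ONLY (nothing cited as a fact): the delta method (Cramér
1946; van der Vaart 1998 Thm 3.1); Kong's ESS (Kong–Liu–Wong, JASA 89 (1994)).  NEW WORK of the
cell; no definition is introduced.

## Content (`ν = μ.withDensity q`; `w = p/q`; `M₂ = ∫ p²/q dμ`; `ξ = 2M₂w − w² − M₂`)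

§1 `memLp_kishScore_model` (`w² ∈ L²(ν)` is row 4's
`KishESSMedian.memLp_sqWeight_model`), `integral_kishScore_model` (`E_ν ξ = 0`),
`integral_weightDev_model`.  §2 `kish_linearisation` (pure algebra).  §3
`integral_sq_sum_weightDev` (`E[(Σ_{i<n}(wᵢ − 1))²] = n(M₂ − 1)`),
**`sqMeanWeightDev_tendstoInMeasure_zero`** (`M₂·√n(W̄ₙ − 1)² → 0` in probability).  §4
**`kishFrac_clt`** — THE THEOREM: for `Y ∼ N(0, ∫ ξ² dν)`, `√n (Kₙ − (∫ p²/q dμ)⁻¹) ⇒ Y/M₂²`,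
`Kₙ` the PRINTED Kish fraction (any normalisation `c ≠ 0`).

NOT CLAIMED: a studentised version; the ESS `= 0` regime (no `√n` law there); Berry–Esseen; any
number of ours re-scored.
-/

noncomputable section

namespace Summit.Ventures.LatticeQCDFlow.Scoring.CardConsistency

open MeasureTheory ProbabilityTheory Finset Real Filter
open scoped Topology Function

/-! ## §1 The linearisation score `ξ = 2M₂w − w² − M₂` under the model law -/

section Model

variable {X : Type*} [MeasurableSpace X] {μ : Measure X} {p q : X → ℝ}

/-- `ξ = 2Mw − w² − M ∈ L²(q dμ)` (any real `M`). [ours] -/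
theorem memLp_kishScore_model
    (hν : IsProbabilityMeasure (μ.withDensity fun z => ENNReal.ofReal (q z)))
    (hpm : Measurable p) (hq0 : ∀ z, 0 < q z) (hqm : Measurable q)
    (hM2i : Integrable (fun z => p z ^ 2 / q z) μ)
    (hM4i : Integrable (fun z => p z ^ 4 / q z ^ 3) μ) (M : ℝ) :
    MemLp (fun a => 2 * M * (p a / q a) - (p a / q a) ^ 2 - M) 2
      (μ.withDensity fun z => ENNReal.ofReal (q z)) :=
  (((AllPairsMedian.memLp_weight_model hpm hq0 hqm hM2i).const_mul (2 * M)).sub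
    (KishESSMedian.memLp_sqWeight_model hpm hq0 hqm hM4i)).sub (memLp_const M)

/-- **The score has mean zero**: `E_ν(2M₂w − w² − M₂) = 2M₂ − M₂ − M₂ = 0` for `M₂ = ∫ p²/q dμ`
and a normalised target. [ours] -/
theorem integral_kishScore_model
    (hν : IsProbabilityMeasure (μ.withDensity fun z => ENNReal.ofReal (q z)))
    (hpm : Measurable p) (hpi : Integrable p μ) (hp1 : ∫ z, p z ∂μ = 1) (hq0 : ∀ z, 0 < q z)
    (hqm : Measurable q) (hM2i : Integrable (fun z => p z ^ 2 / q z) μ) :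
    ∫ a, (2 * (∫ z, p z ^ 2 / q z ∂μ) * (p a / q a) - (p a / q a) ^ 2 - ∫ z, p z ^ 2 / q z ∂μ)
      ∂(μ.withDensity fun z => ENNReal.ofReal (q z)) = 0 := by
  have hw := AllPairsVariance.integral_weight_withDensity_eq (μ := μ) hpi hq0 hqm
  have hw2 : Integrable (fun a => (p a / q a) ^ 2) (μ.withDensity fun z => ENNReal.ofReal (q z)) :=
    (AllPairsMedian.memLp_weight_model hpm hq0 hqm hM2i).integrable_sq
  have hw1 : Integrable (fun a => 2 * (∫ z, p z ^ 2 / q z ∂μ) * (p a / q a))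
      (μ.withDensity fun z => ENNReal.ofReal (q z)) := hw.1.const_mul _
  have h12 : Integrable (fun a => 2 * (∫ z, p z ^ 2 / q z ∂μ) * (p a / q a) - (p a / q a) ^ 2)
      (μ.withDensity fun z => ENNReal.ofReal (q z)) := hw1.sub hw2
  rw [integral_sub h12 (integrable_const _), integral_sub hw1 hw2, integral_const_mul, hw.2, hp1,
    AllPairsMedian.integral_sq_weight_model hq0 hqm, integral_const, smul_eq_mul, probReal_univ]
  ring

/-- `E_ν(w − 1) = 0`. [ours] -/
theorem integral_weightDev_model
    (hν : IsProbabilityMeasure (μ.withDensity fun z => ENNReal.ofReal (q z)))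
    (hpi : Integrable p μ) (hp1 : ∫ z, p z ∂μ = 1) (hq0 : ∀ z, 0 < q z) (hqm : Measurable q) :
    ∫ a, (p a / q a - 1) ∂(μ.withDensity fun z => ENNReal.ofReal (q z)) = 0 := by
  have hw := AllPairsVariance.integral_weight_withDensity_eq (μ := μ) hpi hq0 hqm
  rw [integral_sub hw.1 (integrable_const _), hw.2, hp1, integral_const, smul_eq_mul,
    probReal_univ]
  ring

end Model

/-! ## §2 The linearisation identity -/

section Algebra

/-- **The linearisation of the Kish fraction** (pure algebra): for `s > 0`, `M > 0` and
`S₂/s² > M/2`,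
`s·((S₁/s²)²/(S₂/s²) − M⁻¹) = (s⁻¹(2MS₁ − S₂ − s²M) + M·s·(S₁/s² − 1)²)/(M·max(S₂/s², M/2))`
(read `s = √n`, `S₁ = Σwᵢ`, `S₂ = Σwᵢ²`: `M W̄² − F̄ = mean ξ + M(W̄ − 1)²`). [ours] -/
theorem kish_linearisation {s S₁ S₂ M : ℝ} (hs : 0 < s) (hM : 0 < M) (hF : M / 2 < S₂ / s ^ 2) :
    s * ((S₁ / s ^ 2) ^ 2 / (S₂ / s ^ 2) - M⁻¹)
      = (s⁻¹ * (2 * M * S₁ - S₂ - s ^ 2 * M) + M * (s * (S₁ / s ^ 2 - 1) ^ 2))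
        / (M * max (S₂ / s ^ 2) (M / 2)) := by
  rw [max_eq_left hF.le]
  have hs2 : 0 < s ^ 2 := by positivity
  have hS : 0 < S₂ := by
    have h : 0 < S₂ / s ^ 2 := lt_trans (half_pos hM) hF
    exact (div_pos_iff_of_pos_right hs2).1 h
  field_simp
  ring

end Algebra

/-! ## §3 The square term is `o_P(1)` at the `√n` scale -/

section SquareTerm

variable {Ω : Type*} [MeasurableSpace Ω] {P : Measure Ω} [IsProbabilityMeasure P]
variable {X : Type*} [MeasurableSpace X] {μ : Measure X} {p q : X → ℝ} {y : ℕ → Ω → X}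

/-- **The centred weight sum has variance `n(M₂ − 1)`**: along the stream,
`E[(Σ_{i<n}(wᵢ − 1))²] = n·(M₂ − 1)` (pairwise independence, exact). [ours] -/
theorem integral_sq_sum_weightDev (hym : ∀ j, Measurable (y j)) (hind : iIndepFun y P)
    (hlaw : ∀ j, Measure.map (y j) P = μ.withDensity fun z => ENNReal.ofReal (q z))
    (hpm : Measurable p) (hpi : Integrable p μ) (hp1 : ∫ z, p z ∂μ = 1) (hq0 : ∀ z, 0 < q z)
    (hqm : Measurable q) (hM2i : Integrable (fun z => p z ^ 2 / q z) μ) (n : ℕ) :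
    Integrable (fun ω => (∑ i ∈ range n, (p (y i ω) / q (y i ω) - 1)) ^ 2) P
      ∧ ∫ ω, (∑ i ∈ range n, (p (y i ω) / q (y i ω) - 1)) ^ 2 ∂P
        = n * ((∫ z, p z ^ 2 / q z ∂μ) - 1) := by
  haveI hν : IsProbabilityMeasure (μ.withDensity fun z => ENNReal.ofReal (q z)) :=
    hlaw 0 ▸ Measure.isProbabilityMeasure_map (hym 0).aemeasurable
  have hgm : Measurable fun a => p a / q a - 1 := (hpm.div hqm).sub_const 1
  have hg2 : MemLp (fun a => p a / q a - 1) 2 (μ.withDensity fun z => ENNReal.ofReal (q z)) :=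
    (AllPairsMedian.memLp_weight_model hpm hq0 hqm hM2i).sub (memLp_const 1)
  have hgi : ∀ i, MemLp (fun ω => p (y i ω) / q (y i ω) - 1) 2 P := fun i =>
    ((hlaw i).symm ▸ hg2 : MemLp (fun a => p a / q a - 1) 2 (Measure.map (y i) P)).comp_of_map
      (hym i).aemeasurable
  -- the sum is square-integrable
  have e : (∑ i ∈ range n, fun ω => p (y i ω) / q (y i ω) - 1)
      = fun ω => ∑ i ∈ range n, (p (y i ω) / q (y i ω) - 1) := by
    funext ω
    simp only [Finset.sum_apply]
  have hS2 : MemLp (fun ω => ∑ i ∈ range n, (p (y i ω) / q (y i ω) - 1)) 2 P :=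
    e ▸ memLp_finsetSum' (range n) (fun i _ => hgi i)
  refine ⟨hS2.integrable_sq, ?_⟩
  -- mean zero, so the second moment is the variance
  have hmean_i : ∀ i, ∫ ω, (p (y i ω) / q (y i ω) - 1) ∂P = 0 := fun i => by
    rw [integral_comp_stream hym hlaw (g := fun a => p a / q a - 1) hgm i]
    exact integral_weightDev_model hν hpi hp1 hq0 hqm
  have hmean : ∫ ω, ∑ i ∈ range n, (p (y i ω) / q (y i ω) - 1) ∂P = 0 := by
    simp only [integral_finsetSum _ fun i _ => (hgi i).integrable one_le_two, hmean_i,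
      sum_const_zero]
  have hvar_eq := variance_eq_sub hS2
  simp only [Pi.pow_apply] at hvar_eq
  rw [hmean, zero_pow two_ne_zero, sub_zero] at hvar_eq
  rw [← hvar_eq]
  -- the variance of the sum is the sum of the variances
  have hpair : Set.Pairwise ↑(range n) fun i j =>
      IndepFun (fun ω => p (y i ω) / q (y i ω) - 1) (fun ω => p (y j ω) / q (y j ω) - 1) P :=
    fun i _ j _ hij => pairwise_indepFun_comp_stream hind hgm hij
  have hvs := IndepFun.variance_sum (μ := P)
    (X := fun i ω => p (y i ω) / q (y i ω) - 1) (s := range n) (fun i _ => hgi i) hpair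
  rw [e] at hvs; rw [hvs]
  -- each variance is `M₂ − 1`
  have hw := AllPairsVariance.integral_weight_withDensity_eq (μ := μ) hpi hq0 hqm
  have hw2 : Integrable (fun a => (p a / q a) ^ 2) (μ.withDensity fun z => ENNReal.ofReal (q z)) :=
    (AllPairsMedian.memLp_weight_model hpm hq0 hqm hM2i).integrable_sq
  have hvi : ∀ i, Var[fun ω => p (y i ω) / q (y i ω) - 1; P] = (∫ z, p z ^ 2 / q z ∂μ) - 1 := by
    intro i
    rw [variance_eq_sub (hgi i)]
    simp only [Pi.pow_apply]
    rw [hmean_i i, integral_comp_stream hym hlaw (g := fun a => (p a / q a - 1) ^ 2)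
      (hgm.pow_const 2) i]
    have e : (fun a => (p a / q a - 1) ^ 2) = fun a => ((p a / q a) ^ 2 - 2 * (p a / q a)) + 1 := by
      funext a
      ring
    have hw1 : Integrable (fun a => 2 * (p a / q a))
        (μ.withDensity fun z => ENNReal.ofReal (q z)) := hw.1.const_mul 2
    have h12 : Integrable (fun a => (p a / q a) ^ 2 - 2 * (p a / q a))
        (μ.withDensity fun z => ENNReal.ofReal (q z)) := hw2.sub hw1
    rw [e, integral_add h12 (integrable_const _), integral_sub hw2 hw1, integral_const_mul, hw.2,
      hp1, AllPairsMedian.integral_sq_weight_model hq0 hqm, integral_const, smul_eq_mul,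
      probReal_univ]
    ring
  rw [sum_congr rfl fun i _ => hvi i, sum_const, card_range, nsmul_eq_mul]

/-- **The square term of the linearisation vanishes in probability at the `√n` scale**:
`M₂·√n·(W̄ₙ − 1)² → 0` in probability — its expectation is exactly `M₂(M₂ − 1)/√n`. [ours] -/
theorem sqMeanWeightDev_tendstoInMeasure_zero (hym : ∀ j, Measurable (y j)) (hind : iIndepFun y P)
    (hlaw : ∀ j, Measure.map (y j) P = μ.withDensity fun z => ENNReal.ofReal (q z))
    (hpm : Measurable p) (hpi : Integrable p μ) (hp1 : ∫ z, p z ∂μ = 1) (hq0 : ∀ z, 0 < q z)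
    (hqm : Measurable q) (hM2i : Integrable (fun z => p z ^ 2 / q z) μ) :
    TendstoInMeasure P (fun (n : ℕ) ω => (∫ z, p z ^ 2 / q z ∂μ)
        * (Real.sqrt n * ((∑ i ∈ range n, p (y i ω) / q (y i ω)) / n - 1) ^ 2))
      atTop (fun _ => (0 : ℝ)) := by
  haveI hν : IsProbabilityMeasure (μ.withDensity fun z => ENNReal.ofReal (q z)) :=
    hlaw 0 ▸ Measure.isProbabilityMeasure_map (hym 0).aemeasurable
  set M : ℝ := ∫ z, p z ^ 2 / q z ∂μ with hM
  have hM1 : 1 ≤ M := KishESSMedian.one_le_secondMoment_model hν hpm hpi hp1 hq0 hqm hM2i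
  have hM0 : 0 ≤ M := zero_le_one.trans hM1
  refine tendstoInMeasure_zero_of_integral_le (fun n ω => by positivity)
    (b := fun n : ℕ => M * (M - 1) / Real.sqrt n) ?_ ?_
  · exact tendsto_const_nhds.div_atTop
      (Real.tendsto_sqrt_atTop.comp tendsto_natCast_atTop_atTop)
  · filter_upwards [eventually_ge_atTop 1] with n hn
    have hn0 : (0 : ℝ) < n := by exact_mod_cast hn
    have hsq : 0 < Real.sqrt n := Real.sqrt_pos.2 hn0
    obtain ⟨hI, hE⟩ := integral_sq_sum_weightDev hym hind hlaw hpm hpi hp1 hq0 hqm hM2i n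
    -- `M √n (W̄ − 1)² = (M √n / n²)·(Σ (wᵢ − 1))²`
    have e : (fun ω => M * (Real.sqrt n * ((∑ i ∈ range n, p (y i ω) / q (y i ω)) / n - 1) ^ 2))
        = fun ω => M * Real.sqrt n / (n : ℝ) ^ 2
          * (∑ i ∈ range n, (p (y i ω) / q (y i ω) - 1)) ^ 2 := by
      funext ω
      rw [sum_sub_distrib, sum_const, card_range, nsmul_eq_mul, mul_one]
      field_simp
    rw [e]
    refine ⟨hI.const_mul _, le_of_eq ?_⟩
    rw [integral_const_mul, hE, ← hM]
    have h1 : Real.sqrt n * n / (n : ℝ) ^ 2 = 1 / Real.sqrt n := by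
      rw [pow_two, mul_div_mul_right _ _ hn0.ne', Real.sqrt_div_self']
    calc M * Real.sqrt n / (n : ℝ) ^ 2 * (n * (M - 1))
        = M * (M - 1) * (Real.sqrt n * n / (n : ℝ) ^ 2) := by ring
      _ = M * (M - 1) / Real.sqrt n := by rw [h1]; ring

end SquareTerm

/-! ## §4 The central limit theorem for the printed Kish fraction -/

section CLT

variable {Ω : Type*} [MeasurableSpace Ω] {P : Measure Ω} [IsProbabilityMeasure P]
variable {Ω' : Type*} [MeasurableSpace Ω'] {P' : Measure Ω'} [IsProbabilityMeasure P']
variable {X : Type*} [MeasurableSpace X] {μ : Measure X} {p q : X → ℝ} {y : ℕ → Ω → X}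
variable {Y : Ω' → ℝ}

/-- **ASYMPTOTIC NORMALITY OF THE PRINTED KISH ESS FRACTION.**  One independent proposal stream
`yᵢ` (laws `ν = μ.withDensity q`); `p` measurable, integrable, `∫ p dμ = 1`; `q > 0` measurable;
second and FOURTH weight moments `p²/q, p⁴/q³ ∈ L¹(μ)`; weights printed with ANY normalisation
`w̃ = c·p/q`, `c ≠ 0`; `M₂ = ∫ p²/q dμ`; `Y` any real random variable with law `N(0, σ²_K)`,
`σ²_K = ∫ (2M₂w − w² − M₂)² dν`.  Then for the printed Kish fraction
`Kₙ = (Σ_{i<n} w̃ᵢ)²/(n·Σ_{i<n} w̃ᵢ²)`: `√n·(Kₙ − 1/M₂) ⇒ Y/M₂²` in distribution (limit law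
`N(0, σ²_K/M₂⁴)`). [ours] -/
theorem kishFrac_clt (hym : ∀ j, Measurable (y j)) (hind : iIndepFun y P)
    (hlaw : ∀ j, Measure.map (y j) P = μ.withDensity fun z => ENNReal.ofReal (q z))
    (hpm : Measurable p) (hpi : Integrable p μ) (hp1 : ∫ z, p z ∂μ = 1) (hq0 : ∀ z, 0 < q z)
    (hqm : Measurable q) (hM2i : Integrable (fun z => p z ^ 2 / q z) μ)
    (hM4i : Integrable (fun z => p z ^ 4 / q z ^ 3) μ) {wt : X → ℝ} {c : ℝ} (hc : c ≠ 0)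
    (hwt : ∀ z, wt z = c * (p z / q z))
    (hY : HasLaw Y (gaussianReal 0 (∫ a, (2 * (∫ z, p z ^ 2 / q z ∂μ) * (p a / q a)
      - (p a / q a) ^ 2 - ∫ z, p z ^ 2 / q z ∂μ) ^ 2
      ∂(μ.withDensity fun z => ENNReal.ofReal (q z))).toNNReal) P') :
    TendstoInDistribution (fun (n : ℕ) ω => Real.sqrt n *
        (kishESS (range n) (fun i => wt (y i ω)) / n - (∫ z, p z ^ 2 / q z ∂μ)⁻¹))
      atTop (fun ω' => Y ω' / (∫ z, p z ^ 2 / q z ∂μ) ^ 2) (fun _ => P) P' := by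
  haveI hν : IsProbabilityMeasure (μ.withDensity fun z => ENNReal.ofReal (q z)) :=
    hlaw 0 ▸ Measure.isProbabilityMeasure_map (hym 0).aemeasurable
  -- the square term, before abbreviating `M₂`
  have hR := sqMeanWeightDev_tendstoInMeasure_zero hym hind hlaw hpm hpi hp1 hq0 hqm hM2i
  obtain ⟨M, hM⟩ : ∃ M : ℝ, M = ∫ z, p z ^ 2 / q z ∂μ := ⟨_, rfl⟩
  rw [← hM] at hY hR ⊢
  have hM1 : 1 ≤ M := hM ▸ KishESSMedian.one_le_secondMoment_model hν hpm hpi hp1 hq0 hqm hM2i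
  have hM0 : 0 < M := one_pos.trans_le hM1
  have hwm : Measurable fun a => p a / q a := hpm.div hqm
  -- the score stream and Mathlib's central limit theorem
  have hgm : Measurable fun a => 2 * M * (p a / q a) - (p a / q a) ^ 2 - M :=
    ((hwm.const_mul _).sub (hwm.pow_const 2)).sub_const M
  have hg2 : MemLp (fun a => 2 * M * (p a / q a) - (p a / q a) ^ 2 - M) 2
      (μ.withDensity fun z => ENNReal.ofReal (q z)) :=
    memLp_kishScore_model hν hpm hq0 hqm hM2i hM4i M
  have hg2' : MemLp (fun a => 2 * M * (p a / q a) - (p a / q a) ^ 2 - M) 2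
      (Measure.map (y 0) P) := (hlaw 0).symm ▸ hg2
  have hZ2 : MemLp (fun ω => 2 * M * (p (y 0 ω) / q (y 0 ω)) - (p (y 0 ω) / q (y 0 ω)) ^ 2 - M)
      2 P := hg2'.comp_of_map (hym 0).aemeasurable
  have hZind : iIndepFun (fun k ω =>
      2 * M * (p (y k ω) / q (y k ω)) - (p (y k ω) / q (y k ω)) ^ 2 - M) P :=
    hind.comp (fun _ => fun a => 2 * M * (p a / q a) - (p a / q a) ^ 2 - M) fun _ => hgm
  have hZid : ∀ i, IdentDistrib
      (fun ω => 2 * M * (p (y i ω) / q (y i ω)) - (p (y i ω) / q (y i ω)) ^ 2 - M)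
      (fun ω => 2 * M * (p (y 0 ω) / q (y 0 ω)) - (p (y 0 ω) / q (y 0 ω)) ^ 2 - M) P P :=
    fun i => identDistrib_comp_stream hym hlaw
      (g := fun a => 2 * M * (p a / q a) - (p a / q a) ^ 2 - M) hgm i
  have hZmean : ∫ ω, (2 * M * (p (y 0 ω) / q (y 0 ω)) - (p (y 0 ω) / q (y 0 ω)) ^ 2 - M) ∂P
      = 0 := by
    rw [integral_comp_stream hym hlaw
      (g := fun a => 2 * M * (p a / q a) - (p a / q a) ^ 2 - M) hgm 0, hM]
    exact integral_kishScore_model hν hpm hpi hp1 hq0 hqm hM2i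
  have hZvar : Var[fun ω => 2 * M * (p (y 0 ω) / q (y 0 ω)) - (p (y 0 ω) / q (y 0 ω)) ^ 2 - M; P]
      = ∫ a, (2 * M * (p a / q a) - (p a / q a) ^ 2 - M) ^ 2
        ∂(μ.withDensity fun z => ENNReal.ofReal (q z)) := by
    rw [variance_eq_sub hZ2]
    simp only [Pi.pow_apply]
    rw [hZmean, integral_comp_stream hym hlaw
      (g := fun a => (2 * M * (p a / q a) - (p a / q a) ^ 2 - M) ^ 2) (hgm.pow_const 2) 0]
    ring
  have hY' : HasLaw Y (gaussianReal 0 (Var[fun ω =>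
      2 * M * (p (y 0 ω) / q (y 0 ω)) - (p (y 0 ω) / q (y 0 ω)) ^ 2 - M; P]).toNNReal) P' := by
    rw [hZvar]
    exact hY
  have hclt := tendstoInDistribution_inv_sqrt_mul_sum_sub (P := P) (P' := P')
    (X := fun k ω => 2 * M * (p (y k ω) / q (y k ω)) - (p (y k ω) / q (y k ω)) ^ 2 - M)
    hY' hZ2 hZind hZid
  simp only [hZmean, mul_zero, sub_zero] at hclt
  -- numerator: CLT term plus the square term `→ 0` in probability
  have hSm : ∀ n : ℕ, Measurable fun ω => (Real.sqrt (n : ℝ))⁻¹ *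
      ∑ k ∈ range n, (2 * M * (p (y k ω) / q (y k ω)) - (p (y k ω) / q (y k ω)) ^ 2 - M) :=
    fun n => (Finset.measurable_sum _ fun k _ => hgm.comp (hym k)).const_mul _
  have hWm : ∀ n : ℕ, Measurable fun ω => (∑ i ∈ range n, p (y i ω) / q (y i ω)) / n := fun n =>
    (Finset.measurable_sum _ fun i _ => hwm.comp (hym i)).div_const _
  have hRm : ∀ n : ℕ, Measurable fun ω =>
      M * (Real.sqrt n * ((∑ i ∈ range n, p (y i ω) / q (y i ω)) / n - 1) ^ 2) := fun n =>
    ((((hWm n).sub_const 1).pow_const 2).const_mul _).const_mul _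
  have hnum := hclt.add_of_tendstoInMeasure_const hR (fun n => (hRm n).aemeasurable)
  simp only [add_zero] at hnum
  -- denominator: `F̄ₙ → M₂` almost surely, hence in probability
  have hFm : ∀ n : ℕ, Measurable fun ω => (∑ i ∈ range n, (p (y i ω) / q (y i ω)) ^ 2) / n :=
    fun n => (Finset.measurable_sum _ fun i _ => (hwm.pow_const 2).comp (hym i)).div_const _
  have hFae := sqWeightMean_tendsto_ae hym hind hlaw hpm hq0 hqm hM2i
  rw [← hM] at hFae
  have hF : TendstoInMeasure P (fun (n : ℕ) ω => (∑ i ∈ range n, (p (y i ω) / q (y i ω)) ^ 2) / n)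
      atTop (fun _ => M) :=
    tendstoInMeasure_of_tendsto_ae (fun n => (hFm n).aestronglyMeasurable) hFae
  -- Slutsky with `g(x, d) = x / (M·max(d, M/2))`
  have hden : ∀ d : ℝ, M * max d (M / 2) ≠ 0 := fun d =>
    mul_ne_zero hM0.ne' (lt_max_of_lt_right (half_pos hM0)).ne'
  have hgc : Continuous fun z : ℝ × ℝ => z.1 / (M * max z.2 (M / 2)) :=
    continuous_fst.div (continuous_const.mul (continuous_snd.max continuous_const))
      fun z => hden z.2
  have hsl := hnum.continuous_comp_prodMk_of_tendstoInMeasure_const hgc hF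
    (fun n => (hFm n).aemeasurable)
  have elim : (fun ω' => Y ω' / (M * max M (M / 2))) = fun ω' => Y ω' / M ^ 2 := by
    funext ω'
    rw [max_eq_left (by linarith), sq]
  rw [elim] at hsl
  -- the printed statistic: `Kₙ = W̄ₙ²/F̄ₙ` whatever `c`, and measurability
  have hKeq : ∀ n : ℕ, (fun ω => Real.sqrt n *
      (kishESS (range n) (fun i => wt (y i ω)) / n - M⁻¹)) = fun ω => Real.sqrt n *
      (((∑ i ∈ range n, p (y i ω) / q (y i ω)) / n) ^ 2
        / ((∑ i ∈ range n, (p (y i ω) / q (y i ω)) ^ 2) / n) - M⁻¹) := by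
    intro n
    funext ω
    rw [kishFrac_stream_eq hc hwt y ω n]
  have hKm : ∀ n : ℕ, Measurable fun ω => Real.sqrt n *
      (kishESS (range n) (fun i => wt (y i ω)) / n - M⁻¹) := by
    intro n
    rw [hKeq n]
    exact ((((hWm n).pow_const 2).div (hFm n)).sub_const _).const_mul _
  refine tendstoInDistribution_of_tendstoInMeasure_sub (μ'' := P) (μ' := P') _ _ hsl ?_
    (fun n => (hKm n).aemeasurable)
  refine tendstoInMeasure_of_tendsto_ae (fun n => ((hKm n).sub (((hSm n).add (hRm n)).div
    ((hFm n).max measurable_const |>.const_mul M))).aestronglyMeasurable) ?_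
  filter_upwards [hFae] with ω hFω
  have hpos : ∀ᶠ n : ℕ in atTop,
      M / 2 < (∑ i ∈ range n, (p (y i ω) / q (y i ω)) ^ 2) / n :=
    hFω.eventually_const_lt (by linarith)
  refine (tendsto_const_nhds (x := (0 : ℝ))).congr' ?_
  filter_upwards [hpos, eventually_ge_atTop 1] with n hF hn1
  have hn0 : (0 : ℝ) < n := by exact_mod_cast hn1
  have hnsq : Real.sqrt n ^ 2 = n := Real.sq_sqrt hn0.le
  rw [Pi.sub_apply, Pi.sub_apply, kishFrac_stream_eq hc hwt y ω n]
  -- the linearisation identity with `s = √n`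
  have h := kish_linearisation (S₁ := ∑ i ∈ range n, p (y i ω) / q (y i ω))
    (S₂ := ∑ i ∈ range n, (p (y i ω) / q (y i ω)) ^ 2) (Real.sqrt_pos.2 hn0) hM0
    (by rw [hnsq]; exact hF)
  rw [hnsq] at h
  have hsum : ∑ k ∈ range n, (2 * M * (p (y k ω) / q (y k ω)) - (p (y k ω) / q (y k ω)) ^ 2 - M)
      = 2 * M * (∑ i ∈ range n, p (y i ω) / q (y i ω))
        - (∑ i ∈ range n, (p (y i ω) / q (y i ω)) ^ 2) - n * M := by
    simp only [sum_sub_distrib, mul_sum, sum_const, card_range, nsmul_eq_mul]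
  rw [h, ← hsum]
  refine Eq.symm (sub_eq_zero.2 ?_)
  rfl

end CLT

end Summit.Ventures.LatticeQCDFlow.Scoring.CardConsistency

end
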